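import Summits.BirchSwinnertonDyer.BirchSwinnertonDyer.Theorems.BiquadraticEisensteinDescentEisensteinDivisibilityCMInertBadFlatAtOneStubE2
import Summits.BirchSwinnertonDyer.BirchSwinnertonDyer.Theorems.BiquadraticEisensteinDescentEisensteinDivisibilityCMInertBadFlatAtOneAbsIrr
import Literature.NumberTheory.EllipticCurves.YanZhu2026.GreenbergDivisibilityProofs
import HarnessLib

set_option linter.dupNamespace false -- `Summit.BirchSwinnertonDyer.BirchSwinnertonDyer.Theorems.…` (summit = sub)
set_option autoImplicit false

/-!
# Crux (E♭°) `EisensteinDivisibilityCMInertBadFlatAtOne` (stmt-BirchSwinnertonDyer-20452), line `birth`: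
# the HEART STATED IN THE ♭-RECEPTACLE `𝓞_{ℂ_p}⟦T⟧`, and the crux from it granted ONE named fact (Hsieh Thm. B)

Route `BiquadraticEisensteinDescent` (cell `pub/bsd-wall`, lead-prover seat `bsd-wall-bed-p1`, g5, 2026-08-27). The landed
composition of record (`…FlatAtOneOfFactsIrr.flatAtOne_of_stubE1B_of_facts_odd`, p527689; threaded form
`…FlatAtOneOfPrintOfHeart.ofPrint_of_heart`, bed-p2) reduces the crux to the heart `stub_E1B` stated for `R₀`-FRAMES
`L ∈ R₀⟦T⟧` (`IsBDPLFunction`), at the price of THREE named facts ((A∞) Hsieh Thm. A any level and (R) BDP13 central-value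
reciprocity — only to produce an `R₀`-frame at the datum, `stub_E0` — and (B) Hsieh Thm. B any level) and the extra binder
`Odd (discr K′)` (inherited from (R)), which the post-freeze recipe therefore threads into the K′-supply crux (`…AdmOdd`).

This file removes (A∞), (R) and `Odd` from the E-cone by stating the heart where the crux lives: for ♭-FRAMES
`Q ∈ 𝓞_{ℂ_p}⟦T⟧` (`X11b.R1.IsBDPLFunctionInt`, the crux's own frame binder). The two algebraic steps of the line survive the
change of receptacle although `𝓞_{ℂ_p}` is neither noetherian nor discretely valued:

* §1 PRIME AVOIDANCE in `𝓞_{ℂ_p}⟦T⟧` (the ♭-analogue of the landed `…StubE3.stub_E3`): if `Q` has UNIT CONTENT (a unit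
  coefficient; the ♭-form of "`μ = 0`") then `Q ∣ C(a)·g ⇒ Q ∣ g` for every scalar `a ≠ 0`, in particular for `a = p^m`
  (`dvd_of_hasUnitContent_of_dvd_C_mul`, `le_span_of_forall_C_pow_mul_mem`). Proof: `Q` is a Weierstrass divisor at the
  ideal `(ϖ)` generated by a lower coefficient of largest norm, `𝓞_{ℂ_p}` is `(ϖ)`-adically complete
  (`isAdicComplete_padicComplexInt_span_singleton`), and `𝓞_{ℂ_p}⟦T⟧/(Q)` is then torsion-free
  (`Literature.RingTheory.PowerSeries.dvd_of_isWeierstrassDivisorAt_of_dvd_C_mul`, Bourbaki AC VII §3 no. 8 Prop. 5).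
* §2 UNIT CONTENT OF EVERY ♭-FRAME from (B) + (Irr) (the ♭-form of `stub_E2`): one ♭-frame with unit content exists
  (`…StubE2.exists_flatFrame_hasUnitContent_of_thmB_anyLevel`, p519061) and all ♭-frames of a datum are unit multiples of
  each other (`X11b.R1.exists_unit_mul_eq_of_isBDPLFunctionInt`); (Irr) is bed-p1 g3's THEOREM
  `…FlatAtOneAbsIrr.absIrrModPBaseChangeCMInert` (p526727).
* §3 THE ♭-HEART `HeartFlat` (hypothesis `hHeart`, spelled out; = the planner's `Heart.sig` 5eacee2ea27f33a9 with the frame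
  binders `(ΩK Ωp L), IsBDPLFunction …` replaced by the crux's `(ΩK Ωp Q), R1.IsBDPLFunctionInt …` and the conclusion read in
  `𝓞_{ℂ_p}⟦T⟧`: `Λ`-torsion of `X_ac(W/K′)_{𝔭′-str}` ⟹ `∃ m, p^m·Ch_Λ(X_ac)·𝓞_{ℂ_p}⟦T⟧ ⊆ (Q)`) and the compositions:
  `ofPrintFlat_of_heartFlat_of_absIrr : HeartFlat → AbsIrr → OfPrintFlat` and `ofPrintFlat_of_heartFlat : HeartFlat →
  OfPrintFlat`, where `OfPrintFlat` = the planner's `E10.sig` cb6187bfb9c6896d WITHOUT its antecedents (A∞), (R) and WITHOUT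
  the binder `Odd (NumberField.discr K)` — i.e. `(B) → ∀ <crux binders verbatim, + Λ-torsion of X_ac after the 𝔭′ binders>,
  <crux conclusion verbatim>`; and `flatAtOne_of_heartFlat'_of_thmB` — the crux's statement VERBATIM (no torsion binder)
  from (B) and the torsion-free variant `HeartFlat'` of the ♭-heart.

Upshot for the route author (post-freeze restate, recipe rev9/README FINAL): promoting the heart as `HeartFlat` instead of
`Heart.sig` leaves ONE literature antecedent (B) in the E-cone and keeps the K′-supply crux KS 20198 as it is (no `Odd`).
Mathematical content is unchanged: any proof of the `R₀`-heart that also produces its `R₀`-frame (Katz) gives `HeartFlat` by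
ideal rigidity (`…StubEa`), and `HeartFlat` at `Q = map L` gives the `R₀`-heart's containment read in `𝓞_{ℂ_p}⟦T⟧`.

THEOREMS ONLY (no definition, no named fact, no `sorry`); imports no `Theses` module (statements spelled out); CONDITIONAL on
the hypotheses displayed ((B) a named fact; the ♭-heart OPEN research, NOT IN PRINT — see the seat's mechanism census memo).
Supports, does not close, stmt-BirchSwinnertonDyer-20452. Nothing is asserted about the heart, about (B), or about BSD.

References: [Hsieh2014] M.-L. Hsieh, Doc. Math. 19 (2014), Thm. B p. 712; [Castella2018] F. Castella, arXiv:1704.06608, Thm. 3.1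
p. 9 (the frame); [BourbakiAC5to7] N. Bourbaki, Algèbre commutative VII §3 no. 8 Prop. 5 (Weierstrass division);
[GreenbergVatsal2000] p. 2 (1)–(2) (unit content = `μ = 0`).
-/

noncomputable section

open scoped Classical NumberField

open PowerSeries NumberField IsDedekindDomain Field WeierstrassCurve
  Literature.NumberTheory.EllipticCurves Literature.NumberTheory.EllipticCurves.ModularForms
  Literature.NumberTheory.EllipticCurves.Rank1Residual
  Literature.NumberTheory.GaloisRepresentations
  Literature.NumberTheory.EllipticCurves.GreenbergVatsal2000
  Literature.NumberTheory.EllipticCurves.Hida2010MuInvariant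
  Literature.NumberTheory.EllipticCurves.Hsieh2014
  Literature.RingTheory.PowerSeries
  Summit.BirchSwinnertonDyer.Rank1Residual.X11b
  Summit.BirchSwinnertonDyer.Rank1Residual.X11b.AcSelmer Summit.BirchSwinnertonDyer.Rank1Residual.X11b.Halves
  Summit.BirchSwinnertonDyer.BirchSwinnertonDyer.Theorems.BiquadraticEisensteinDescentEisensteinDivisibilityCMInertBadFlatAtOneStubE2
  Summit.BirchSwinnertonDyer.BirchSwinnertonDyer.Theorems.BiquadraticEisensteinDescentEisensteinDivisibilityCMInertBadFlatAtOneAbsIrr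

namespace Summit.BirchSwinnertonDyer.BirchSwinnertonDyer.Theorems.BiquadraticEisensteinDescentEisensteinDivisibilityCMInertBadFlatAtOneOfHeartFlat

variable {p : ℕ} [Fact p.Prime]

/-! ### §1 Prime avoidance in `𝓞_{ℂ_p}⟦T⟧` under unit content -/

/-- **A power series over `𝓞_{ℂ_p}` with unit content divides `C(a)·g` (`a ≠ 0` a scalar) only if it divides `g`.**
With `n` the least index of a unit coefficient of `Q` and `ϖ` a lower coefficient of largest norm (`‖ϖ‖ < 1`), `Q` is a
Weierstrass divisor at `(ϖ)`, `𝓞_{ℂ_p}` is `(ϖ)`-adically complete, and `𝓞_{ℂ_p}⟦T⟧/(Q) ≅ 𝓞_{ℂ_p}[T]/(P)` is a free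
`𝓞_{ℂ_p}`-module, hence torsion-free. (The one-variable case of the tree's
`dvd_of_dvd_map_C_mul_of_hasUnitContent_minus`.) [cite: BourbakiAC5to7, Ch. VII §3 no. 8, Prop. 5 (B = M ⊕ fB, M free on 1, X, …, X^{s−1})] -/
theorem dvd_of_hasUnitContent_of_dvd_C_mul {Q g : PowerSeries 𝓞_ℂ_[p]} (hQ : HasUnitContent Q)
    {a : 𝓞_ℂ_[p]} (ha : a ≠ 0) (h : Q ∣ PowerSeries.C a * g) : Q ∣ g := by
  have hex : ∃ n, IsUnit (PowerSeries.coeff n Q) := hQ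
  set n := Nat.find hex with hn_def
  have hn : IsUnit (PowerSeries.coeff n Q) := Nat.find_spec hex
  have hlt : ∀ j < n, ¬ IsUnit (PowerSeries.coeff j Q) := fun j hj ↦ Nat.find_min hex hj
  -- a lower coefficient `ϖ` of largest norm (or `0` if `n = 0`)
  obtain ⟨ϖ, hϖ, hmem⟩ : ∃ ϖ : 𝓞_ℂ_[p], ‖(ϖ : ℂ_[p])‖ < 1 ∧
      ∀ j < n, PowerSeries.coeff j Q ∈ Ideal.span {ϖ} := by
    by_cases hn0 : n = 0
    · exact ⟨0, by simp, fun j hj ↦ absurd hj (by omega)⟩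
    · obtain ⟨j₀, hj₀, hmax⟩ := (Finset.range n).exists_max_image
        (fun j ↦ ‖((PowerSeries.coeff j Q : 𝓞_ℂ_[p]) : ℂ_[p])‖) (Finset.nonempty_range_iff.mpr hn0)
      refine ⟨PowerSeries.coeff j₀ Q, ?_, fun j hj ↦ ?_⟩
      · exact lt_of_le_of_ne (norm_coe_padicComplexInt_le_one _) fun h1 ↦
          hlt j₀ (Finset.mem_range.mp hj₀) (isUnit_padicComplexInt_iff.mpr h1)
      · exact Ideal.mem_span_singleton.mpr
          (padicComplexInt_dvd_of_norm_le (hmax j (Finset.mem_range.mpr hj)))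
  set I : Ideal 𝓞_ℂ_[p] := Ideal.span {ϖ} with hI_def
  haveI : IsAdicComplete I 𝓞_ℂ_[p] := isAdicComplete_padicComplexInt_span_singleton hϖ
  have hI : I ≠ ⊤ := span_singleton_padicComplexInt_ne_top hϖ
  have hW : Q.IsWeierstrassDivisorAt I := isWeierstrassDivisorAt_of_coeff_mem_of_isUnit hI hmem hn
  exact dvd_of_isWeierstrassDivisorAt_of_dvd_C_mul hW ha h

/-- `p ≠ 0` in `𝓞_{ℂ_p}`. [folklore] -/
theorem natCast_prime_ne_zero : ((p : ℕ) : 𝓞_ℂ_[p]) ≠ 0 := by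
  have hp : p.Prime := Fact.out
  intro h
  have h1 : ‖(((p : ℕ) : 𝓞_ℂ_[p]) : ℂ_[p])‖ = (p : ℝ)⁻¹ := by
    rw [show (((p : ℕ) : 𝓞_ℂ_[p]) : ℂ_[p]) = ((p : ℚ_[p]) : ℂ_[p]) by simp, PadicComplex.norm_extends',
      Padic.norm_p]
  rw [h] at h1
  simp only [ZeroMemClass.coe_zero, norm_zero] at h1
  exact (inv_ne_zero (by exact_mod_cast hp.ne_zero)) h1.symm

/-- **Ideal form of prime avoidance**: if `Q ∈ 𝓞_{ℂ_p}⟦T⟧` has unit content and `p^m·𝔞 ⊆ (Q)`, then `𝔞 ⊆ (Q)`.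
[cite: BourbakiAC5to7, Ch. VII §3 no. 8, Prop. 5 (B = M ⊕ fB, M free on 1, X, …, X^{s−1})] -/
theorem le_span_of_forall_C_pow_mul_mem {Q : PowerSeries 𝓞_ℂ_[p]} (hQ : HasUnitContent Q)
    {𝔞 : Ideal (PowerSeries 𝓞_ℂ_[p])} {m : ℕ}
    (h : ∀ x ∈ 𝔞, (PowerSeries.C ((p : ℕ) : 𝓞_ℂ_[p]) : PowerSeries 𝓞_ℂ_[p]) ^ m * x ∈ Ideal.span {Q}) :
    𝔞 ≤ Ideal.span {Q} := by
  intro x hx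
  refine Ideal.mem_span_singleton.mpr (dvd_of_hasUnitContent_of_dvd_C_mul hQ
    (pow_ne_zero m natCast_prime_ne_zero) ?_)
  rw [map_pow]
  exact Ideal.mem_span_singleton.mp (h x hx)

/-! ### §2 Every ♭-frame has unit content, from (B) and (Irr) -/

variable {K : Type} [Field K] [NumberField K] {N : ℕ} {ι : PadicAlgCl p ≃+* ℂ}
  {𝔭 : HeightOneSpectrum (𝓞 K)} {κ : ZpExtension K p} {γ : Field.absoluteGaloisGroup K}
  {f : CuspForm (CongruenceSubgroup.Gamma0 N) 2}

/-- **(B) + (Irr) ⟹ EVERY Castella ♭-frame of the datum has unit content.** For `p` odd with `p ∣ N`, `f` a newform of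
`W` of level `N`, `K` imaginary quadratic Heegner for `N`, `𝔭 ∋ p` the prime induced by `ι`, `κ` anticyclotomic with
topological generator `γ`, and every framed mod-`p` representation of `W/K` absolutely irreducible: a ♭-frame `Q₀` with
unit content exists (`exists_flatFrame_hasUnitContent_of_thmB_anyLevel`), and any ♭-frame `Q` (periods `Ω_K ≠ 0`,
`Ω_p ≠ 0`) is a unit multiple of it (`R1.exists_unit_mul_eq_of_isBDPLFunctionInt`), so `Q` has unit content
(`hasUnitContent_congr_of_associated`). CONDITIONAL on the named fact (B).
[cite: Hsieh2014, Thm. B p. 712 (Doc. Math. 19)] [cite: Castella2018, Thm. 3.1 (arXiv:1704.06608 p. 9)] -/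
theorem hasUnitContent_of_isBDPLFunctionInt_of_thmB_anyLevel
    (hB : thmB_exists_isHsiehLFunction_coeff_norm_eq_one_unrPeriod_anyLevel)
    (W : WeierstrassCurve ℚ) [W.IsElliptic] [NeZero N] (hp2 : p ≠ 2) (hpN : p ∣ N) (hf : IsNewformOf W f)
    (hK : IsImaginaryQuadratic K) (hHN : SatisfiesHeegnerHypothesis N K)
    (h𝔭 : ((p : ℕ) : 𝓞 K) ∈ 𝔭.asIdeal)
    (hι : ∀ (w : InfinitePlace K) (k : 𝓞 K), k ∈ 𝔭.asIdeal ↔ ‖ι.symm (w.embedding (k : K))‖ < 1)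
    (hIrr : ∀ ρ : ModPGaloisRep K (ZMod p) 2, (W.baseChange K).IsTorsionGaloisRep p ρ →
      FramedRep.IsAbsolutelyIrreducible ρ)
    (hκ : κ.IsAnticyclotomic) (hγ : κ.IsTopGenerator γ)
    {ΩK : ℂ} {Ωp : ℂ_[p]} {Q : PowerSeries 𝓞_ℂ_[p]} (hΩK : ΩK ≠ 0) (hΩp : Ωp ≠ 0)
    (hQ : R1.IsBDPLFunctionInt p ι 𝔭 κ γ f ΩK Ωp Q) : HasUnitContent Q := by
  obtain ⟨ΩK₀, Ωp₀, Q₀, hΩK₀, hQ₀, hQ₀c⟩ := exists_flatFrame_hasUnitContent_of_thmB_anyLevel hB W hp2 hpN hf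
    hK hHN h𝔭 hι hIrr hκ hγ
  obtain ⟨U, hU, hUQ⟩ := R1.exists_unit_mul_eq_of_isBDPLFunctionInt hp2 hK hκ hγ hΩK₀ hΩK
    (coe_units_unrIntegers_ne_zero Ωp₀) hΩp hQ₀ hQ
  have hass : Associated Q₀ Q := by
    obtain ⟨u, rfl⟩ := hU
    exact ⟨u, by rw [hUQ, mul_comm]⟩
  exact (hasUnitContent_congr_of_associated hass).mp hQ₀c

/-! ### §3 The ♭-heart and the compositions -/

/-- **`OfPrintFlat` ⟸ `HeartFlat` + `AbsIrr`** — the ♭-analogue of `…FlatAtOneOfPrintOfParts.ofPrint_of_heart_of_absIrr`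
(p524778). Hypotheses, spelled out: `hHeart` = the ♭-HEART (planner's `Heart.sig` 5eacee2ea27f33a9 with the frame binders
`(ΩK Ωp L), IsBDPLFunction …` replaced by the crux's `(ΩK Ωp Q), R1.IsBDPLFunctionInt …` and the containment read in
`𝓞_{ℂ_p}⟦T⟧`: under Λ-torsion of `X_ac(W/K′)_{𝔭′-str}`, `∃ m, p^m·Ch_Λ(X_ac)·𝓞_{ℂ_p}⟦T⟧ ⊆ (Q)`); `hIrr` = `AbsIrr9.sig`
14045b46b4dacdf9 verbatim (a theorem, p526727 — discharged in `ofPrintFlat_of_heartFlat`). Conclusion = the planner's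
`E10.sig` cb6187bfb9c6896d with the antecedents (A∞), (R) and the binder `Odd (NumberField.discr K)` DELETED: (B) → at every
datum of the crux (binders verbatim) with `X_ac(W/K′)_{𝔭′-str}` Λ-torsion, the constant terms of `Ch_Λ(X_ac)` lie in
`Q(𝟙)·𝓞_{ℂ_p}`. Chain: unit content of `Q` (§2) → `hHeart` → prime avoidance (§1) → constant terms. CONDITIONAL on (B) and on
`hHeart` (OPEN). [cite: Hsieh2014, Thm. B p. 712 (Doc. Math. 19)] [cite: Castella2018, Thm. 3.1 (arXiv:1704.06608 p. 9)] -/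
theorem ofPrintFlat_of_heartFlat_of_absIrr
    (hHeart : ∀ (W : WeierstrassCurve ℚ) [W.IsElliptic] [W.IsGloballyMinimal] (p : ℕ) [Fact p.Prime]
      [NeZero (W.conductorNorm ℤ)] (K : Type) [Field K] [NumberField K],
      W.HasCM → W.analyticRank = 1 → 5 ≤ p → CMInert W p → ¬ Good W p →
      IsImaginaryQuadratic K → SatisfiesHeegnerHypothesis (W.conductorNorm ℤ) K →
      4 < (NumberField.discr K).natAbs →
      (∀ (L : Type) [Field L] [NumberField L], Module.finrank ℚ L = 4 →
        (∃ x : L, x ^ 2 = ((cmFieldDiscrOfJ W.j : ℤ) : L)) → (∃ y : L, y ^ 2 = ((NumberField.discr K : ℤ) : L)) →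
        ¬ p ∣ NumberField.classNumber L) →
      (W.quadraticTwist (NumberField.discr K : ℚ)).entireLFunction 1 ≠ 0 →
      ∀ (κ : ZpExtension K p), κ.IsAnticyclotomic →
        ∀ (γ : Field.absoluteGaloisGroup K) [Fact (κ.IsTopGenerator γ)]
          (𝔭 : HeightOneSpectrum (𝓞 K)), ((p : ℕ) : 𝓞 K) ∈ 𝔭.asIdeal →
          𝔭.asIdeal.ramificationIdx (𝓞 ℚ) = 1 → 𝔭.asIdeal.inertiaDeg (𝓞 ℚ) = 1 →
          ∀ (f : CuspForm (CongruenceSubgroup.Gamma0 (W.conductorNorm ℤ)) 2), IsNewformOf W f →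
            ∀ (ι' : PadicAlgCl p ≃+* ℂ),
              (∀ (w : InfinitePlace K) (k : 𝓞 K), k ∈ 𝔭.asIdeal ↔ ‖ι'.symm (w.embedding (k : K))‖ < 1) →
              ∀ (ΩK : ℂ) (Ωp : (unrIntegers p)ˣ) (Q : PowerSeries (PadicComplexInt p)), ΩK ≠ 0 →
                R1.IsBDPLFunctionInt p ι' 𝔭 κ γ f ΩK ((Ωp : unrIntegers p) : (PadicComplex p)) Q →
                  ∀ (𝔭' : HeightOneSpectrum (𝓞 K)), ((p : ℕ) : 𝓞 K) ∈ 𝔭'.asIdeal → 𝔭' ≠ 𝔭 →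
                  Module.IsTorsion (IwasawaAlgebra p) (XAc (W.baseChange K) p κ 𝔭' ∅ γ) →
                  ∃ m : ℕ, ∀ x ∈ (XAc.charIdeal (W.baseChange K) p κ 𝔭' ∅ γ).map (PowerSeries.map (R1.toCpInt p)),
                    (PowerSeries.C ((p : ℕ) : PadicComplexInt p) : PowerSeries (PadicComplexInt p)) ^ m * x ∈
                      Ideal.span {Q})
    (hIrr : ∀ (W : WeierstrassCurve ℚ) [W.IsElliptic] [W.IsGloballyMinimal] (p : ℕ) [Fact p.Prime]
      [NeZero (W.conductorNorm ℤ)], W.HasCM → 5 ≤ p → CMInert W p → ¬ Good W p →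
      ∀ (K : Type) [Field K] [NumberField K], IsImaginaryQuadratic K →
        SatisfiesHeegnerHypothesis (W.conductorNorm ℤ) K →
        ∀ ρ : ModPGaloisRep K (ZMod p) 2, (W.baseChange K).IsTorsionGaloisRep p ρ →
          FramedRep.IsAbsolutelyIrreducible ρ) :
  thmB_exists_isHsiehLFunction_coeff_norm_eq_one_unrPeriod_anyLevel →
  ∀ (W : WeierstrassCurve ℚ) [W.IsElliptic] [W.IsGloballyMinimal] (p : ℕ) [Fact p.Prime]
    [NeZero (W.conductorNorm ℤ)] (K : Type) [Field K] [NumberField K],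
    W.HasCM → W.analyticRank = 1 → 5 ≤ p → CMInert W p → ¬ Good W p →
    IsImaginaryQuadratic K → SatisfiesHeegnerHypothesis (W.conductorNorm ℤ) K →
    4 < (NumberField.discr K).natAbs →
    (∀ (L : Type) [Field L] [NumberField L], Module.finrank ℚ L = 4 →
      (∃ x : L, x ^ 2 = ((cmFieldDiscrOfJ W.j : ℤ) : L)) → (∃ y : L, y ^ 2 = ((NumberField.discr K : ℤ) : L)) →
      ¬ p ∣ NumberField.classNumber L) →
    (W.quadraticTwist (NumberField.discr K : ℚ)).entireLFunction 1 ≠ 0 →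
    ∀ (κ : ZpExtension K p), κ.IsAnticyclotomic →
      ∀ (γ : Field.absoluteGaloisGroup K) [Fact (κ.IsTopGenerator γ)]
        (𝔭 : HeightOneSpectrum (𝓞 K)), ((p : ℕ) : 𝓞 K) ∈ 𝔭.asIdeal →
        𝔭.asIdeal.ramificationIdx (𝓞 ℚ) = 1 → 𝔭.asIdeal.inertiaDeg (𝓞 ℚ) = 1 →
        ∀ (𝔭' : HeightOneSpectrum (𝓞 K)), ((p : ℕ) : 𝓞 K) ∈ 𝔭'.asIdeal → 𝔭' ≠ 𝔭 →
        Module.IsTorsion (IwasawaAlgebra p) (XAc (W.baseChange K) p κ 𝔭' ∅ γ) →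
        ∀ (f : CuspForm (CongruenceSubgroup.Gamma0 (W.conductorNorm ℤ)) 2), IsNewformOf W f →
          ∀ (ι' : PadicAlgCl p ≃+* ℂ),
            (∀ (w : InfinitePlace K) (k : 𝓞 K), k ∈ 𝔭.asIdeal ↔ ‖ι'.symm (w.embedding (k : K))‖ < 1) →
            ∀ (ΩK : ℂ) (Ωp : (unrIntegers p)ˣ) (Q : PowerSeries (PadicComplexInt p)), ΩK ≠ 0 →
              R1.IsBDPLFunctionInt p ι' 𝔭 κ γ f ΩK ((Ωp : unrIntegers p) : (PadicComplex p)) Q →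
                (XAc.charIdeal (W.baseChange K) p κ 𝔭' ∅ γ).map
                    ((R1.toCpInt p).comp (PowerSeries.constantCoeff : IwasawaAlgebra p →+* ℤ_[p])) ≤
                  Ideal.span {PowerSeries.constantCoeff Q} := by
  intro hB W _ _ p _ _ K _ _ hCM hr hp5 hin hbad hK hHN hd4 hadm hLt κ hκ γ hγ 𝔭 h𝔭 he hf 𝔭' h𝔭' hne htors f
    hfW ι' hι' ΩK Ωp Q hΩK hQ
  have hp2 : p ≠ 2 := by omega
  have hpN : p ∣ W.conductorNorm ℤ := (W.dvd_conductorNorm_iff_not_hasGoodReductionAtPrime p).mpr hbad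
  -- (E2♭) unit content of `Q`, from (B) + (Irr)
  have hQc : HasUnitContent Q :=
    hasUnitContent_of_isBDPLFunctionInt_of_thmB_anyLevel hB W hp2 hpN hfW hK hHN h𝔭 hι'
      (hIrr W p hCM hp5 hin hbad K hK hHN) hκ hγ.out hΩK (coe_units_unrIntegers_ne_zero Ωp) hQ
  -- the ♭-heart: containment up to `p^m`
  obtain ⟨m, hm⟩ := hHeart W p K hCM hr hp5 hin hbad hK hHN hd4 hadm hLt κ hκ γ 𝔭 h𝔭 he hf f hfW ι' hι' ΩK Ωp
    Q hΩK hQ 𝔭' h𝔭' hne htors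
  -- (E3♭) prime avoidance
  have hflat : (XAc.charIdeal (W.baseChange K) p κ 𝔭' ∅ γ).map (PowerSeries.map (R1.toCpInt p)) ≤
      Ideal.span {Q} := le_span_of_forall_C_pow_mul_mem hQc hm
  -- constant terms
  have hcc : ∀ g : IwasawaAlgebra p, PowerSeries.constantCoeff (PowerSeries.map (R1.toCpInt p) g) =
      R1.toCpInt p (PowerSeries.constantCoeff g) := fun g ↦ by
    rw [← PowerSeries.coeff_zero_eq_constantCoeff_apply, PowerSeries.coeff_map,
      PowerSeries.coeff_zero_eq_constantCoeff_apply]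
  have hcomp : (R1.toCpInt p).comp (PowerSeries.constantCoeff : IwasawaAlgebra p →+* ℤ_[p]) =
      (PowerSeries.constantCoeff : PowerSeries 𝓞_ℂ_[p] →+* 𝓞_ℂ_[p]).comp (PowerSeries.map (R1.toCpInt p)) := by
    ext g
    simp [hcc]
  rw [hcomp, ← Ideal.map_map]
  refine (Ideal.map_mono hflat).trans ?_
  rw [Ideal.map_span, Set.image_singleton]

/-- **`OfPrintFlat` ⟸ `HeartFlat` ALONE**: `ofPrintFlat_of_heartFlat_of_absIrr` with (Irr) DISCHARGED by bed-p1 g3's theorem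
`…FlatAtOneAbsIrr.absIrrModPBaseChangeCMInert` (p526727). So, granted (B) Hsieh Thm. B at any level, the crux (with the
Λ-torsion binder that C′ supplies) follows from the ♭-heart — no (A∞), no (R), no `Odd d_K′`, no (Irr). CONDITIONAL on the
♭-heart (OPEN) and on (B) in the conclusion's antecedent. [cite: Hsieh2014, Thm. B p. 712 (Doc. Math. 19)] -/
theorem ofPrintFlat_of_heartFlat
    (hHeart : ∀ (W : WeierstrassCurve ℚ) [W.IsElliptic] [W.IsGloballyMinimal] (p : ℕ) [Fact p.Prime]
      [NeZero (W.conductorNorm ℤ)] (K : Type) [Field K] [NumberField K],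
      W.HasCM → W.analyticRank = 1 → 5 ≤ p → CMInert W p → ¬ Good W p →
      IsImaginaryQuadratic K → SatisfiesHeegnerHypothesis (W.conductorNorm ℤ) K →
      4 < (NumberField.discr K).natAbs →
      (∀ (L : Type) [Field L] [NumberField L], Module.finrank ℚ L = 4 →
        (∃ x : L, x ^ 2 = ((cmFieldDiscrOfJ W.j : ℤ) : L)) → (∃ y : L, y ^ 2 = ((NumberField.discr K : ℤ) : L)) →
        ¬ p ∣ NumberField.classNumber L) →
      (W.quadraticTwist (NumberField.discr K : ℚ)).entireLFunction 1 ≠ 0 →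
      ∀ (κ : ZpExtension K p), κ.IsAnticyclotomic →
        ∀ (γ : Field.absoluteGaloisGroup K) [Fact (κ.IsTopGenerator γ)]
          (𝔭 : HeightOneSpectrum (𝓞 K)), ((p : ℕ) : 𝓞 K) ∈ 𝔭.asIdeal →
          𝔭.asIdeal.ramificationIdx (𝓞 ℚ) = 1 → 𝔭.asIdeal.inertiaDeg (𝓞 ℚ) = 1 →
          ∀ (f : CuspForm (CongruenceSubgroup.Gamma0 (W.conductorNorm ℤ)) 2), IsNewformOf W f →
            ∀ (ι' : PadicAlgCl p ≃+* ℂ),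
              (∀ (w : InfinitePlace K) (k : 𝓞 K), k ∈ 𝔭.asIdeal ↔ ‖ι'.symm (w.embedding (k : K))‖ < 1) →
              ∀ (ΩK : ℂ) (Ωp : (unrIntegers p)ˣ) (Q : PowerSeries (PadicComplexInt p)), ΩK ≠ 0 →
                R1.IsBDPLFunctionInt p ι' 𝔭 κ γ f ΩK ((Ωp : unrIntegers p) : (PadicComplex p)) Q →
                  ∀ (𝔭' : HeightOneSpectrum (𝓞 K)), ((p : ℕ) : 𝓞 K) ∈ 𝔭'.asIdeal → 𝔭' ≠ 𝔭 →
                  Module.IsTorsion (IwasawaAlgebra p) (XAc (W.baseChange K) p κ 𝔭' ∅ γ) →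
                  ∃ m : ℕ, ∀ x ∈ (XAc.charIdeal (W.baseChange K) p κ 𝔭' ∅ γ).map (PowerSeries.map (R1.toCpInt p)),
                    (PowerSeries.C ((p : ℕ) : PadicComplexInt p) : PowerSeries (PadicComplexInt p)) ^ m * x ∈
                      Ideal.span {Q}) :
  thmB_exists_isHsiehLFunction_coeff_norm_eq_one_unrPeriod_anyLevel →
  ∀ (W : WeierstrassCurve ℚ) [W.IsElliptic] [W.IsGloballyMinimal] (p : ℕ) [Fact p.Prime]
    [NeZero (W.conductorNorm ℤ)] (K : Type) [Field K] [NumberField K],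
    W.HasCM → W.analyticRank = 1 → 5 ≤ p → CMInert W p → ¬ Good W p →
    IsImaginaryQuadratic K → SatisfiesHeegnerHypothesis (W.conductorNorm ℤ) K →
    4 < (NumberField.discr K).natAbs →
    (∀ (L : Type) [Field L] [NumberField L], Module.finrank ℚ L = 4 →
      (∃ x : L, x ^ 2 = ((cmFieldDiscrOfJ W.j : ℤ) : L)) → (∃ y : L, y ^ 2 = ((NumberField.discr K : ℤ) : L)) →
      ¬ p ∣ NumberField.classNumber L) →
    (W.quadraticTwist (NumberField.discr K : ℚ)).entireLFunction 1 ≠ 0 →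
    ∀ (κ : ZpExtension K p), κ.IsAnticyclotomic →
      ∀ (γ : Field.absoluteGaloisGroup K) [Fact (κ.IsTopGenerator γ)]
        (𝔭 : HeightOneSpectrum (𝓞 K)), ((p : ℕ) : 𝓞 K) ∈ 𝔭.asIdeal →
        𝔭.asIdeal.ramificationIdx (𝓞 ℚ) = 1 → 𝔭.asIdeal.inertiaDeg (𝓞 ℚ) = 1 →
        ∀ (𝔭' : HeightOneSpectrum (𝓞 K)), ((p : ℕ) : 𝓞 K) ∈ 𝔭'.asIdeal → 𝔭' ≠ 𝔭 →
        Module.IsTorsion (IwasawaAlgebra p) (XAc (W.baseChange K) p κ 𝔭' ∅ γ) →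
        ∀ (f : CuspForm (CongruenceSubgroup.Gamma0 (W.conductorNorm ℤ)) 2), IsNewformOf W f →
          ∀ (ι' : PadicAlgCl p ≃+* ℂ),
            (∀ (w : InfinitePlace K) (k : 𝓞 K), k ∈ 𝔭.asIdeal ↔ ‖ι'.symm (w.embedding (k : K))‖ < 1) →
            ∀ (ΩK : ℂ) (Ωp : (unrIntegers p)ˣ) (Q : PowerSeries (PadicComplexInt p)), ΩK ≠ 0 →
              R1.IsBDPLFunctionInt p ι' 𝔭 κ γ f ΩK ((Ωp : unrIntegers p) : (PadicComplex p)) Q →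
                (XAc.charIdeal (W.baseChange K) p κ 𝔭' ∅ γ).map
                    ((R1.toCpInt p).comp (PowerSeries.constantCoeff : IwasawaAlgebra p →+* ℤ_[p])) ≤
                  Ideal.span {PowerSeries.constantCoeff Q} :=
  ofPrintFlat_of_heartFlat_of_absIrr hHeart absIrrModPBaseChangeCMInert

/-- **The crux (E♭°) VERBATIM (item stmt-BirchSwinnertonDyer-20452, no torsion binder) ⟸ (B) + the torsion-free ♭-heart
`HeartFlat'`** (= `HeartFlat` without its `Module.IsTorsion` antecedent; like the registered `stub_E1B`, it then also
asserts the heart on the branch where `X_ac` is not Λ-torsion, on which `Ch_Λ = ⊤`). Recorded to show what the rev-8 item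
AS FILED costs: exactly (B) beyond `HeartFlat'`. CONDITIONAL on (B) and on `HeartFlat'` (OPEN).
[cite: Hsieh2014, Thm. B p. 712 (Doc. Math. 19)] -/
theorem flatAtOne_of_heartFlat'_of_thmB
    (hB : thmB_exists_isHsiehLFunction_coeff_norm_eq_one_unrPeriod_anyLevel)
    (hHeart : ∀ (W : WeierstrassCurve ℚ) [W.IsElliptic] [W.IsGloballyMinimal] (p : ℕ) [Fact p.Prime]
      [NeZero (W.conductorNorm ℤ)] (K : Type) [Field K] [NumberField K],
      W.HasCM → W.analyticRank = 1 → 5 ≤ p → CMInert W p → ¬ Good W p →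
      IsImaginaryQuadratic K → SatisfiesHeegnerHypothesis (W.conductorNorm ℤ) K →
      4 < (NumberField.discr K).natAbs →
      (∀ (L : Type) [Field L] [NumberField L], Module.finrank ℚ L = 4 →
        (∃ x : L, x ^ 2 = ((cmFieldDiscrOfJ W.j : ℤ) : L)) → (∃ y : L, y ^ 2 = ((NumberField.discr K : ℤ) : L)) →
        ¬ p ∣ NumberField.classNumber L) →
      (W.quadraticTwist (NumberField.discr K : ℚ)).entireLFunction 1 ≠ 0 →
      ∀ (κ : ZpExtension K p), κ.IsAnticyclotomic →
        ∀ (γ : Field.absoluteGaloisGroup K) [Fact (κ.IsTopGenerator γ)]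
          (𝔭 : HeightOneSpectrum (𝓞 K)), ((p : ℕ) : 𝓞 K) ∈ 𝔭.asIdeal →
          𝔭.asIdeal.ramificationIdx (𝓞 ℚ) = 1 → 𝔭.asIdeal.inertiaDeg (𝓞 ℚ) = 1 →
          ∀ (f : CuspForm (CongruenceSubgroup.Gamma0 (W.conductorNorm ℤ)) 2), IsNewformOf W f →
            ∀ (ι' : PadicAlgCl p ≃+* ℂ),
              (∀ (w : InfinitePlace K) (k : 𝓞 K), k ∈ 𝔭.asIdeal ↔ ‖ι'.symm (w.embedding (k : K))‖ < 1) →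
              ∀ (ΩK : ℂ) (Ωp : (unrIntegers p)ˣ) (Q : PowerSeries (PadicComplexInt p)), ΩK ≠ 0 →
                R1.IsBDPLFunctionInt p ι' 𝔭 κ γ f ΩK ((Ωp : unrIntegers p) : (PadicComplex p)) Q →
                  ∀ (𝔭' : HeightOneSpectrum (𝓞 K)), ((p : ℕ) : 𝓞 K) ∈ 𝔭'.asIdeal → 𝔭' ≠ 𝔭 →
                  ∃ m : ℕ, ∀ x ∈ (XAc.charIdeal (W.baseChange K) p κ 𝔭' ∅ γ).map (PowerSeries.map (R1.toCpInt p)),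
                    (PowerSeries.C ((p : ℕ) : PadicComplexInt p) : PowerSeries (PadicComplexInt p)) ^ m * x ∈
                      Ideal.span {Q}) :
  ∀ (W : WeierstrassCurve ℚ) [W.IsElliptic] [W.IsGloballyMinimal] (p : ℕ) [Fact p.Prime]
    [NeZero (W.conductorNorm ℤ)] (K : Type) [Field K] [NumberField K],
    W.HasCM → W.analyticRank = 1 → 5 ≤ p → CMInert W p → ¬ Good W p →
    IsImaginaryQuadratic K → SatisfiesHeegnerHypothesis (W.conductorNorm ℤ) K →
    4 < (NumberField.discr K).natAbs →
    (∀ (L : Type) [Field L] [NumberField L], Module.finrank ℚ L = 4 →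
      (∃ x : L, x ^ 2 = ((cmFieldDiscrOfJ W.j : ℤ) : L)) → (∃ y : L, y ^ 2 = ((NumberField.discr K : ℤ) : L)) →
      ¬ p ∣ NumberField.classNumber L) →
    (W.quadraticTwist (NumberField.discr K : ℚ)).entireLFunction 1 ≠ 0 →
    ∀ (κ : ZpExtension K p), κ.IsAnticyclotomic →
      ∀ (γ : Field.absoluteGaloisGroup K) [Fact (κ.IsTopGenerator γ)]
        (𝔭 : HeightOneSpectrum (𝓞 K)), ((p : ℕ) : 𝓞 K) ∈ 𝔭.asIdeal →
        𝔭.asIdeal.ramificationIdx (𝓞 ℚ) = 1 → 𝔭.asIdeal.inertiaDeg (𝓞 ℚ) = 1 →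
        ∀ (𝔭' : HeightOneSpectrum (𝓞 K)), ((p : ℕ) : 𝓞 K) ∈ 𝔭'.asIdeal → 𝔭' ≠ 𝔭 →
        ∀ (f : CuspForm (CongruenceSubgroup.Gamma0 (W.conductorNorm ℤ)) 2), IsNewformOf W f →
          ∀ (ι' : PadicAlgCl p ≃+* ℂ),
            (∀ (w : InfinitePlace K) (k : 𝓞 K), k ∈ 𝔭.asIdeal ↔ ‖ι'.symm (w.embedding (k : K))‖ < 1) →
            ∀ (ΩK : ℂ) (Ωp : (unrIntegers p)ˣ) (Q : PowerSeries (PadicComplexInt p)), ΩK ≠ 0 →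
              R1.IsBDPLFunctionInt p ι' 𝔭 κ γ f ΩK ((Ωp : unrIntegers p) : (PadicComplex p)) Q →
                (XAc.charIdeal (W.baseChange K) p κ 𝔭' ∅ γ).map
                    ((R1.toCpInt p).comp (PowerSeries.constantCoeff : IwasawaAlgebra p →+* ℤ_[p])) ≤
                  Ideal.span {PowerSeries.constantCoeff Q} := by
  intro W _ _ p _ _ K _ _ hCM hr hp5 hin hbad hK hHN hd4 hadm hLt κ hκ γ hγ 𝔭 h𝔭 he hf 𝔭' h𝔭' hne f hfW ι' hι'
    ΩK Ωp Q hΩK hQ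
  have hp2 : p ≠ 2 := by omega
  have hpN : p ∣ W.conductorNorm ℤ := (W.dvd_conductorNorm_iff_not_hasGoodReductionAtPrime p).mpr hbad
  have hQc : HasUnitContent Q :=
    hasUnitContent_of_isBDPLFunctionInt_of_thmB_anyLevel hB W hp2 hpN hfW hK hHN h𝔭 hι'
      (absIrrModPBaseChangeCMInert W p hCM hp5 hin hbad K hK hHN) hκ hγ.out hΩK (coe_units_unrIntegers_ne_zero Ωp) hQ
  obtain ⟨m, hm⟩ := hHeart W p K hCM hr hp5 hin hbad hK hHN hd4 hadm hLt κ hκ γ 𝔭 h𝔭 he hf f hfW ι' hι' ΩK Ωp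
    Q hΩK hQ 𝔭' h𝔭' hne
  have hflat : (XAc.charIdeal (W.baseChange K) p κ 𝔭' ∅ γ).map (PowerSeries.map (R1.toCpInt p)) ≤
      Ideal.span {Q} := le_span_of_forall_C_pow_mul_mem hQc hm
  have hcc : ∀ g : IwasawaAlgebra p, PowerSeries.constantCoeff (PowerSeries.map (R1.toCpInt p) g) =
      R1.toCpInt p (PowerSeries.constantCoeff g) := fun g ↦ by
    rw [← PowerSeries.coeff_zero_eq_constantCoeff_apply, PowerSeries.coeff_map,
      PowerSeries.coeff_zero_eq_constantCoeff_apply]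
  have hcomp : (R1.toCpInt p).comp (PowerSeries.constantCoeff : IwasawaAlgebra p →+* ℤ_[p]) =
      (PowerSeries.constantCoeff : PowerSeries 𝓞_ℂ_[p] →+* 𝓞_ℂ_[p]).comp (PowerSeries.map (R1.toCpInt p)) := by
    ext g
    simp [hcc]
  rw [hcomp, ← Ideal.map_map]
  refine (Ideal.map_mono hflat).trans ?_
  rw [Ideal.map_span, Set.image_singleton]

end Summit.BirchSwinnertonDyer.BirchSwinnertonDyer.Theorems.BiquadraticEisensteinDescentEisensteinDivisibilityCMInertBadFlatAtOneOfHeartFlat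

end
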